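import Summits.NavierStokesRegularity.NavierStokesRegularity.Theorems.EulerZoomLiouvillePowerGaugeEulerLiouvilleBreatherWeakProfile
import Summits.NavierStokesRegularity.NavierStokesRegularity.Theorems.EulerZoomLiouvillePowerGaugeEulerLiouvilleBreatherWeakPressure
import Summits.NavierStokesRegularity.NavierStokesRegularity.Theorems.EulerZoomLiouvillePowerGaugeEulerLiouvilleBreatherLocData

/-!
# Crux `EulerZoomLiouville.PowerGaugeEulerLiouville` (stmt-NavierStokesRegularity-19832), line `logtime-breathers` (T3, weak residue):
# LARGE-SCALE CLASS DATA of a WEAK log-time breather in profile variables, one constant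

Width seat `ns-ezl-w4` (g3; weak breather rigidity, file D1 — the weak twin of `BreatherRigidity.exists_locData`).  Under the weak-gradient and
three-gauge hypotheses of the crux class (`0 < ρ ≤ ½`), for a pair with `u(τ, y) = e^{cτ} V(e^{−cτ} y)` and the EXACT (slaved) breather pressure
`p(τ, y) = (e^{cτ})² Q(e^{−cτ} y)` (`τ < 0`; `Q` measurable) there are a profile gradient `G` (a weak derivative of `V` on `ℝ³`) and ONE constant `c'`
with, for all `L ≥ 1`: `∫_{B_L}|V|² ≤ c' L^{1−2ρ}`, `∫_{B_L}|G|²_F ≤ L^{1−ρ}((1−ρ)/(2+ρ))c'`, `∫_{B_L}|Q|^{3/2} ≤ L^{2−2ρ}((2−2ρ)/(2+ρ))c'`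
(`BreatherRigidity.lintegral_ball_profile_le`, `BreatherWeak.profile_gradient_growth_of_gaugeE`, `BreatherWeak.profile_pressure_growth_of_gaugeD`;
thresholds moved to `1`, constants merged exactly as in the classical `BreatherRigidity.exists_locData`) — the input shape of
`WeakProfile.ae_eq_zero_of_locData_of_scaleIneq`.

* `BreatherWeak.exists_locData` — the statement above (+ measurability of `V`, `G`, `Q`).

WHAT THIS IS NOT: not NS regularity, not the crux — bookkeeping for the WEAK breather-rigidity member; `--supports` stmt-19832. [folklore]
-/

noncomputable section

set_option linter.dupNamespace false

open MeasureTheory Set Filter Topology Metric Function TopologicalSpace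
open scoped ENNReal NNReal RealInnerProductSpace ContDiff

namespace Summit.NavierStokesRegularity.NavierStokesRegularity.Theorems.PowerGaugeEulerLiouville

open Literature.Analysis Literature.Analysis.FunctionSpaces Literature.Analysis.FluidPDE

namespace BreatherWeak

variable {u : ℝ → EuclideanSpace ℝ (Fin 3) → EuclideanSpace ℝ (Fin 3)} {p : ℝ → EuclideanSpace ℝ (Fin 3) → ℝ}
  {H : ℝ → EuclideanSpace ℝ (Fin 3) → EuclideanSpace ℝ (Fin 3) →L[ℝ] EuclideanSpace ℝ (Fin 3)}
  {c : ℝ} {V : EuclideanSpace ℝ (Fin 3) → EuclideanSpace ℝ (Fin 3)} {Q : EuclideanSpace ℝ (Fin 3) → ℝ}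

/-- **LARGE-SCALE CLASS DATA OF A WEAK BREATHER IN PROFILE VARIABLES, one constant.**  Under the weak-gradient and three-gauge hypotheses of
the crux class (`0 < ρ ≤ ½`), for `u(τ, y) = e^{cτ} V(e^{−cτ} y)`, `p(τ, y) = (e^{cτ})² Q(e^{−cτ} y)` (`τ < 0`, `Q` measurable, `p` a.e.-strongly
measurable on the slab) there are a profile gradient `G` — a.e.-strongly measurable, a weak derivative of `V` on `ℝ³` — and `c'` with, for all `L ≥ 1`:
`∫_{B_L}|V|² ≤ c' L^{1−2ρ}`, `∫_{B_L}|G|²_F ≤ L^{1−ρ}((1−ρ)/(2+ρ))c'`, `∫_{B_L}|Q|^{3/2} ≤ L^{2−2ρ}((2−2ρ)/(2+ρ))c'`; moreover `V` is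
a.e.-strongly measurable. [folklore] -/
theorem exists_locData {ρ : ℝ} (hρ : 0 < ρ) (hρh : ρ ≤ 1 / 2) {c₀ : ℝ≥0}
    (hH : HasWeakSpatialGradientOn (slab (EuclideanSpace ℝ (Fin 3)) (Iio 0) isOpen_Iio) u H)
    (hgauge : ∀ a : ℝ, 0 < a →
      ENNReal.ofReal (a ^ (2 * ρ)) * cknA a (0 : ℝ × EuclideanSpace ℝ (Fin 3)) u +
          ENNReal.ofReal (a ^ ρ) * cknE a (0 : ℝ × EuclideanSpace ℝ (Fin 3)) H +
        ENNReal.ofReal (a ^ (2 * ρ)) * cknD a (0 : ℝ × EuclideanSpace ℝ (Fin 3)) p ≤ (c₀ : ℝ≥0∞))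
    (hpm : AEStronglyMeasurable (uncurry p)
      (volume.restrict (Iio (0 : ℝ) ×ˢ (univ : Set (EuclideanSpace ℝ (Fin 3))))))
    (hbr : ∀ τ : ℝ, τ < 0 → ∀ y, u τ y = Real.exp (c * τ) • V (Real.exp (-(c * τ)) • y))
    (hp : ∀ τ : ℝ, τ < 0 → ∀ y, p τ y = Real.exp (c * τ) ^ 2 * Q (Real.exp (-(c * τ)) • y)) :
    ∃ (G : EuclideanSpace ℝ (Fin 3) → EuclideanSpace ℝ (Fin 3) →L[ℝ] EuclideanSpace ℝ (Fin 3)) (c' : ℝ≥0),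
      AEStronglyMeasurable V volume ∧ AEStronglyMeasurable G volume ∧
      HasWeakFDerivOn (⊤ : Opens (EuclideanSpace ℝ (Fin 3))) volume V G ∧
      (∀ L : ℝ, 1 ≤ L → ∫⁻ y in ball (0 : EuclideanSpace ℝ (Fin 3)) L, ‖V y‖ₑ ^ 2 ≤
        (c' : ℝ≥0∞) * ENNReal.ofReal (L ^ (1 - 2 * ρ))) ∧
      (∀ L : ℝ, 1 ≤ L →
        ∫⁻ y in ball (0 : EuclideanSpace ℝ (Fin 3)) L, ENNReal.ofReal (frobeniusNormSq (G y)) ≤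
          ENNReal.ofReal (L ^ (1 - ρ)) * (ENNReal.ofReal ((1 - ρ) / (2 + ρ)) * (c' : ℝ≥0∞))) ∧
      (∀ L : ℝ, 1 ≤ L →
        ∫⁻ y in ball (0 : EuclideanSpace ℝ (Fin 3)) L, ‖Q y‖ₑ ^ (3 / 2 : ℝ) ≤
          ENNReal.ofReal (L ^ (2 - 2 * ρ)) * (ENNReal.ofReal ((2 - 2 * ρ) / (2 + ρ)) * (c' : ℝ≥0∞))) := by
  -- adapted from the classical `BreatherRigidity.exists_locData` (…BreatherLocData, ns-ezl-w4 g2)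
  have hρ1 : ρ < 1 := by linarith
  have h2ρ : (0 : ℝ) < 2 + ρ := by linarith
  -- the three gauges separately
  have hA : ∀ a : ℝ, 0 < a → ENNReal.ofReal (a ^ (2 * ρ)) *
      cknA a (0 : ℝ × EuclideanSpace ℝ (Fin 3)) u ≤ (c₀ : ℝ≥0∞) :=
    fun a ha => le_trans (le_trans le_self_add le_self_add) (hgauge a ha)
  have hE : ∀ a : ℝ, 0 < a → ENNReal.ofReal (a ^ ρ) *
      cknE a (0 : ℝ × EuclideanSpace ℝ (Fin 3)) H ≤ (c₀ : ℝ≥0∞) :=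
    fun a ha => le_trans (le_trans le_add_self le_self_add) (hgauge a ha)
  have hD : ∀ a : ℝ, 0 < a → ENNReal.ofReal (a ^ (2 * ρ)) *
      cknD a (0 : ℝ × EuclideanSpace ℝ (Fin 3)) p ≤ (c₀ : ℝ≥0∞) :=
    fun a ha => le_trans le_add_self (hgauge a ha)
  -- measurability of `u`, `H` on the slab; the profile and its weak gradient
  have hum : AEStronglyMeasurable (uncurry u)
      (volume.restrict (Iio (0 : ℝ) ×ˢ (univ : Set (EuclideanSpace ℝ (Fin 3))))) := by
    have := hH.locallyIntegrableOn.aestronglyMeasurable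
    simpa [slab] using this
  have hHm : AEStronglyMeasurable (uncurry H)
      (volume.restrict (Iio (0 : ℝ) ×ˢ (univ : Set (EuclideanSpace ℝ (Fin 3))))) := by
    have := hH.locallyIntegrableOn_grad.aestronglyMeasurable
    simpa [slab] using this
  have hVm : AEStronglyMeasurable V volume := aestronglyMeasurable_profile hum hbr
  obtain ⟨G, hGm, hVG, hHV⟩ := exists_profileGradient_ae hH hbr
  -- ### raw growth bounds
  set CA : ℝ≥0∞ := ENNReal.ofReal (Real.exp ((4 + 2 * ρ) * |c|)) * (c₀ : ℝ≥0∞) with hCA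
  have hCAt : CA ≠ ⊤ := ENNReal.mul_ne_top ENNReal.ofReal_ne_top ENNReal.coe_ne_top
  have hA1 : ∀ L : ℝ, 1 ≤ L → ∫⁻ y in ball (0 : EuclideanSpace ℝ (Fin 3)) L, ‖V y‖ₑ ^ 2 ≤
      CA * ENNReal.ofReal (L ^ (1 - 2 * ρ)) :=
    fun L hL => BreatherRigidity.lintegral_ball_profile_le hρ.le hA hbr (lt_of_lt_of_le one_pos hL)
  set CE : ℝ≥0∞ := ENNReal.ofReal (Real.exp (6 * |c|) * Real.exp (2 * |c|) ^ (1 - ρ)) * (c₀ : ℝ≥0∞) with hCE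
  have hE2 : ∀ L : ℝ, 2 ≤ L →
      ∫⁻ y in ball (0 : EuclideanSpace ℝ (Fin 3)) L, ENNReal.ofReal (frobeniusNormSq (G y)) ≤
        CE * ENNReal.ofReal (L ^ (1 - ρ)) :=
    profile_gradient_growth_of_gaugeE hHm hHV hE
  set CD : ℝ≥0∞ := ENNReal.ofReal (Real.exp (12 * |c|) * Real.exp (2 * |c|) ^ (2 - 2 * ρ)) * (c₀ : ℝ≥0∞) with hCD
  have hD2 : ∀ L : ℝ, 2 ≤ L → ∫⁻ y in ball (0 : EuclideanSpace ℝ (Fin 3)) L, ‖Q y‖ₑ ^ (3 / 2 : ℝ) ≤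
      CD * ENNReal.ofReal (L ^ (2 - 2 * ρ)) :=
    fun L hL => profile_pressure_growth_of_gaugeD hpm hp hD hL
  -- ### thresholds to `L ≥ 1`
  have h12 : (1 : ℝ) ≤ 2 := by norm_num
  have hE1 := Past.growth_ge_one_of_growth_ge h12 (by linarith : (0 : ℝ) ≤ 1 - ρ) hE2
  have hD1 := Past.growth_ge_one_of_growth_ge h12 (by linarith : (0 : ℝ) ≤ 2 - 2 * ρ) hD2
  set CE' : ℝ≥0∞ := CE * ENNReal.ofReal ((2 : ℝ) ^ (1 - ρ)) with hCE'
  set CD' : ℝ≥0∞ := CD * ENNReal.ofReal ((2 : ℝ) ^ (2 - 2 * ρ)) with hCD'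
  have hCE't : CE' ≠ ⊤ :=
    ENNReal.mul_ne_top (ENNReal.mul_ne_top ENNReal.ofReal_ne_top ENNReal.coe_ne_top) ENNReal.ofReal_ne_top
  have hCD't : CD' ≠ ⊤ :=
    ENNReal.mul_ne_top (ENNReal.mul_ne_top ENNReal.ofReal_ne_top ENNReal.coe_ne_top) ENNReal.ofReal_ne_top
  -- ### ONE common constant in the shapes (A₁), (E₁), (D₁)
  set κE : ℝ := (1 - ρ) / (2 + ρ) with hκE
  set κD : ℝ := (2 - 2 * ρ) / (2 + ρ) with hκD
  have hκE0 : 0 < κE := by rw [hκE]; exact div_pos (by linarith) h2ρ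
  have hκD0 : 0 < κD := by rw [hκD]; exact div_pos (by linarith) h2ρ
  set a : ℝ := CA.toReal with ha
  set e : ℝ := CE'.toReal with he
  set d : ℝ := CD'.toReal with hd
  have ha0 : 0 ≤ a := ENNReal.toReal_nonneg
  have he0 : 0 ≤ e := ENNReal.toReal_nonneg
  have hd0 : 0 ≤ d := ENNReal.toReal_nonneg
  set k₀ : ℝ := a + e / κE + d / κD with hk₀
  have hk₀0 : 0 ≤ k₀ := by positivity
  set c' : ℝ≥0 := k₀.toNNReal with hc'
  have hcc : (c' : ℝ≥0∞) = ENNReal.ofReal k₀ := rfl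
  have haC : CA = ENNReal.ofReal a := (ENNReal.ofReal_toReal hCAt).symm
  have heC : CE' = ENNReal.ofReal e := (ENNReal.ofReal_toReal hCE't).symm
  have hdC : CD' = ENNReal.ofReal d := (ENNReal.ofReal_toReal hCD't).symm
  have hAle : CA ≤ (c' : ℝ≥0∞) := by
    rw [haC, hcc]
    refine ENNReal.ofReal_le_ofReal ?_
    have : 0 ≤ e / κE + d / κD := by positivity
    rw [hk₀]; linarith
  have hEle : CE' ≤ ENNReal.ofReal κE * (c' : ℝ≥0∞) := by
    rw [heC, hcc, ← ENNReal.ofReal_mul hκE0.le]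
    refine ENNReal.ofReal_le_ofReal ?_
    have h1 : κE * (e / κE) = e := mul_div_cancel₀ e hκE0.ne'
    have h2 : 0 ≤ κE * a + κE * (d / κD) := by positivity
    rw [hk₀]; nlinarith [h1, h2]
  have hDle : CD' ≤ ENNReal.ofReal κD * (c' : ℝ≥0∞) := by
    rw [hdC, hcc, ← ENNReal.ofReal_mul hκD0.le]
    refine ENNReal.ofReal_le_ofReal ?_
    have h1 : κD * (d / κD) = d := mul_div_cancel₀ d hκD0.ne'
    have h2 : 0 ≤ κD * a + κD * (e / κE) := by positivity
    rw [hk₀]; nlinarith [h1, h2]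
  refine ⟨G, c', hVm, hGm, hVG, fun L hL => (hA1 L hL).trans (mul_le_mul' hAle le_rfl),
    fun L hL => (hE1 L hL).trans ?_, fun L hL => (hD1 L hL).trans ?_⟩
  · rw [mul_comm]; exact mul_le_mul' le_rfl hEle
  · rw [mul_comm]; exact mul_le_mul' le_rfl hDle

end BreatherWeak

end Summit.NavierStokesRegularity.NavierStokesRegularity.Theorems.PowerGaugeEulerLiouville

end
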